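import Summits.Ventures.CertifiedManyBodySolver.Upper.IntervalReaderWitness

/-!
# Ventures/CertifiedManyBodySolver — Upper/IntervalReaderAutomaton.lean: the automaton (MPO) sandwich identity
(part 7 of the Theorem-H1′ package; parts 1–6: `IntervalReaderSchur`, `IntervalReaderTransfer`,
`IntervalReaderH1`, `IntervalReaderBridge`, `IntervalReaderMoments`, `IntervalReaderWitness`)

HONEST FRAMING: first certified bounds; not a superconductivity verdict; every number certified or labelled
float.  Pure multilinear algebra; no claim about the Hubbard model, a producer, a row or the thermodynamic limit.

Theorem H1′ (`h1_sweep_error_le`) is stated for EXACT environments indexed by the states `b : β` of a finite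
automaton, `X (k+1) c = Σ_b transferOp (A k) (O k b c) (X k b)` — the shape of E1's reader (`h1sweep.py`:
`strans[x]` = the transitions `b → c` of site `x` with their site operators `O`).  Part 6 identified these
environments for the ONE-state automaton.  This file does it for ANY finite automaton: with

* `automatonKernel L O σ τ : Matrix β β ℂ` — the ordered product over the sites of the `β × β` matrices
  `(b, c) ↦ O k b c (σ k) (τ k)`; its `(b₀, c)` entry is the kernel of the operator the automaton represents
  between initial state `b₀` and final state `c` (a matrix-product operator; for E1's automaton with its
  Jordan–Wigner sign operators this is — by the code's exact-integer self-test, NOT by a theorem of this tree —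
  `den · H` of the FORMAT-mps1 model);
* `automatonStep A Ok` — one position of the recursion, `(Y b)_b ↦ (Σ_b transferOp A (Ok b c) (Y b))_c`, and
  `automatonSweep L A O` — its fold over the sites (both `ℂ`-linear in the family of environments),

the theorem `inner_mulVec_mpsOpenVar_eq_automatonSweep` says: for the witness `ψ = mpsOpenVar L A l r` and the
operator `W` with kernel `W σ τ = automatonKernel L O σ τ b₀ c`,
`star ψ_l ⬝ᵥ (W *ᵥ ψ_{l′}) = star r ⬝ᵥ (automatonSweep L A O (Pi.single b₀ ((star l) ⊗ l′)) c *ᵥ r′)`,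
and `automatonSweep_succ_apply` records that the swept family obeys exactly the recursion `hX` of
`h1_sweep_error_le`.  CONSEQUENCE FOR THE LINEAGE: the sentence "E1's automaton represents `den · H`" is now the
finite, model-by-model claim `Matrix.of (fun σ τ => automatonKernel L O σ τ b₀ c) = den • H` (in the
Jordan–Wigner basis of the box); given it, parts 3 + 6 + 7 make `h1_sweep_error_le` → `accept_sound` a statement
about `⟨ψ|H|ψ⟩ / ⟨ψ|ψ⟩` of the certificate sentence itself.  That claim is NOT proved here for any model.
-/

noncomputable section

open Matrix Finset
open scoped BigOperators ComplexOrder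

namespace Summit.Ventures.CertifiedManyBodySolver.Upper.IntervalReader

open Literature.MathematicalPhysics.QuantumLattice

variable {q D : ℕ} {β : Type*} [Fintype β] [DecidableEq β]

/-! ## §K  The automaton kernel -/

/-- The automaton (MPO) kernel between configurations `σ, τ`: the ordered product over the sites of the
`β × β` matrices `(b, c) ↦ O k b c (σ k) (τ k)`.  Entry `(b₀, c)` = sum over automaton paths from `b₀` to `c` of
the products of the site-operator entries along the path. -/
def automatonKernel (L : ℕ) (O : Fin L → β → β → Matrix (Fin q) (Fin q) ℂ) (σ τ : TensorIndex (Fin L) q) :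
    Matrix β β ℂ :=
  (List.ofFn fun k : Fin L => Matrix.of fun b c : β => O k b c (σ k) (τ k)).prod

/-- No sites: the kernel is the identity on automaton states. -/
theorem automatonKernel_zero (O : Fin 0 → β → β → Matrix (Fin q) (Fin q) ℂ) (σ τ : TensorIndex (Fin 0) q) :
    automatonKernel 0 O σ τ = 1 := by
  simp [automatonKernel]

/-- Peeling the first site of the kernel: `K_{L+1}(s∷σ, s′∷τ) = M₀(s, s′) · K_L(σ, τ)` with
`M₀(s, s′) b c = O 0 b c s s′`. -/
theorem automatonKernel_succ_cons (L : ℕ) (O : Fin (L + 1) → β → β → Matrix (Fin q) (Fin q) ℂ)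
    (s s' : Fin q) (σ τ : TensorIndex (Fin L) q) :
    automatonKernel (L + 1) O (Fin.cons s σ : Fin (L + 1) → Fin q) (Fin.cons s' τ : Fin (L + 1) → Fin q) =
      (Matrix.of fun b c : β => O 0 b c s s') * automatonKernel L (fun k => O k.succ) σ τ := by
  simp only [automatonKernel, List.ofFn_succ, List.prod_cons, Fin.cons_zero, Fin.cons_succ]

/-! ## §L  The recursion of Theorem H1′ as a linear map on families of environments -/

/-- One position of the reader's recursion on a family of environments indexed by the automaton states:
`(automatonStep A Ok Y) c = Σ_b transferOp A (Ok b c) (Y b)` — the `hX` of `h1_sweep_error_le`. -/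
def automatonStep (A : MPSTensor q D) (Ok : β → β → Matrix (Fin q) (Fin q) ℂ) :
    (β → Matrix (Fin D) (Fin D) ℂ) →ₗ[ℂ] (β → Matrix (Fin D) (Fin D) ℂ) where
  toFun Y := fun c => ∑ b, transferOp A (Ok b c) (Y b)
  map_add' Y Y' := by
    funext c
    simp only [Pi.add_apply, ← Finset.sum_add_distrib]
    exact Finset.sum_congr rfl fun b _ => (transferOpHom A (Ok b c)).map_add (Y b) (Y' b)
  map_smul' z Y := by
    funext c
    simp only [Pi.smul_apply, RingHom.id_apply, Finset.smul_sum]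
    exact Finset.sum_congr rfl fun b _ => transferOp_smul_env A (Ok b c) z (Y b)

omit [DecidableEq β] in
/-- `automatonStep` unfolded. -/
@[simp] theorem automatonStep_apply (A : MPSTensor q D) (Ok : β → β → Matrix (Fin q) (Fin q) ℂ)
    (Y : β → Matrix (Fin D) (Fin D) ℂ) (c : β) :
    automatonStep A Ok Y c = ∑ b, transferOp A (Ok b c) (Y b) := rfl

/-- **The exact environments of the automaton sweep**, as a linear map of the initial family:
`automatonSweep 0 = id`, `automatonSweep (L+1) A O = automatonSweep L (A ∘ succ) (O ∘ succ) ∘ automatonStep (A 0) (O 0)`. -/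
def automatonSweep : (L : ℕ) → (Fin L → MPSTensor q D) → (Fin L → β → β → Matrix (Fin q) (Fin q) ℂ) →
    ((β → Matrix (Fin D) (Fin D) ℂ) →ₗ[ℂ] (β → Matrix (Fin D) (Fin D) ℂ))
  | 0, _, _ => LinearMap.id
  | L + 1, A, O => (automatonSweep L (fun j => A j.succ) (fun j => O j.succ)).comp (automatonStep (A 0) (O 0))

omit [DecidableEq β] in
/-- No sites: the swept family is the initial family. -/
@[simp] theorem automatonSweep_zero (A : Fin 0 → MPSTensor q D) (O : Fin 0 → β → β → Matrix (Fin q) (Fin q) ℂ)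
    (Y : β → Matrix (Fin D) (Fin D) ℂ) : automatonSweep 0 A O Y = Y := rfl

omit [DecidableEq β] in
/-- **The recursion `hX` of `h1_sweep_error_le`.**  One more site: the family after absorbing site `0` is
`c ↦ Σ_b transferOp (A 0) (O 0 b c) (Y b)`, then the remaining sites are swept. -/
theorem automatonSweep_succ_apply (L : ℕ) (A : Fin (L + 1) → MPSTensor q D)
    (O : Fin (L + 1) → β → β → Matrix (Fin q) (Fin q) ℂ) (Y : β → Matrix (Fin D) (Fin D) ℂ) :
    automatonSweep (L + 1) A O Y =
      automatonSweep L (fun j => A j.succ) (fun j => O j.succ)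
        (fun c => ∑ b, transferOp (A 0) (O 0 b c) (Y b)) := rfl

/-- Absorbing site `0` into the rank-one boundary family concentrated at `b₀`: the new family is
`b₁ ↦ transferOp (A 0) (O 0 b₀ b₁) ((star l) ⊗ l′) = Σ_{s,s′} O 0 b₀ b₁ s s′ • (star (l ᵥ* A 0 s)) ⊗ (l′ ᵥ* A 0 s′)`,
i.e. a linear combination of rank-one families concentrated at the `b₁`. -/
theorem automatonStep_single (A : MPSTensor q D) (Ok : β → β → Matrix (Fin q) (Fin q) ℂ) (b₀ : β)
    (l l' : Fin D → ℂ) :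
    automatonStep A Ok (Pi.single b₀ (vecMulVec (star l) l')) =
      ∑ s, ∑ s', ∑ b₁, Ok b₀ b₁ s s' •
        (Pi.single b₁ (vecMulVec (star (l ᵥ* A s)) (l' ᵥ* A s')) : β → Matrix (Fin D) (Fin D) ℂ) := by
  funext c
  rw [automatonStep_apply, Finset.sum_eq_single b₀]
  · rw [Pi.single_eq_same, ← sum_smul_vecMulVec_vecMul_eq_transferOp]
    simp only [Finset.sum_apply, Pi.smul_apply, Pi.single_apply]
    refine Finset.sum_congr rfl fun s _ => Finset.sum_congr rfl fun s' _ => ?_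
    rw [Finset.sum_eq_single c]
    · rw [if_pos rfl]
    · intro b _ hb
      rw [if_neg (Ne.symm hb), smul_zero]
    · intro h; exact absurd (Finset.mem_univ c) h
  · intro b _ hb
    rw [Pi.single_eq_of_ne hb]
    exact (transferOpHom A (Ok b c)).map_zero
  · intro h; exact absurd (Finset.mem_univ b₀) h

/-! ## §M  The sandwich identity -/

/-- Sums over configurations of `L+1` sites split into the first site and the rest. -/
private theorem sum_config_succ {M : Type*} [AddCommMonoid M] (L : ℕ)
    (f : TensorIndex (Fin (L + 1)) q → M) :
    ∑ σ, f σ = ∑ s : Fin q, ∑ τ : TensorIndex (Fin L) q, f (Fin.cons s τ : Fin (L + 1) → Fin q) := by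
  rw [← Fintype.sum_prod_type']
  exact (Fintype.sum_equiv (Fin.consEquiv fun _ => Fin q) _ _ fun p => rfl).symm

/-- **The automaton (MPO) sandwich identity.**  For site-dependent tensors `A`, an automaton with site operators
`O k b c` (states `b, c : β`), initial / final states `b₀, c`, the operator `W` on configurations with kernel
`W σ τ = automatonKernel L O σ τ b₀ c`, and boundary vectors `l, l′, r, r′`:
`star (mpsOpenVar L A l r) ⬝ᵥ (W *ᵥ mpsOpenVar L A l′ r′)`
`= star r ⬝ᵥ (automatonSweep L A O (Pi.single b₀ ((star l) ⊗ l′)) c *ᵥ r′)`.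
With part 6 (`W = Π O`, one state) as the special case `β = Unit`. -/
theorem inner_mulVec_mpsOpenVar_eq_automatonSweep : ∀ (L : ℕ) (A : Fin L → MPSTensor q D)
    (O : Fin L → β → β → Matrix (Fin q) (Fin q) ℂ) (b₀ c : β) (W : Op (Fin L) q)
    (_hW : ∀ σ τ, W σ τ = automatonKernel L O σ τ b₀ c) (l l' r r' : Fin D → ℂ),
    star (mpsOpenVar L A l r) ⬝ᵥ (W *ᵥ mpsOpenVar L A l' r') =
      star r ⬝ᵥ (automatonSweep L A O (Pi.single b₀ (vecMulVec (star l) l')) c *ᵥ r')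
  | 0, A, O, b₀, c, W, hW, l, l', r, r' => by
    -- both sides are `1 b₀ c · star (l ⬝ᵥ r) · (l′ ⬝ᵥ r′)`
    have hK : ∀ σ τ : TensorIndex (Fin 0) q, W σ τ = (1 : Matrix β β ℂ) b₀ c := fun σ τ => by
      rw [hW, automatonKernel_zero]
    have hψ : mpsOpenVar 0 A l r = fun _ => l ⬝ᵥ r := funext (mpsOpenVar_zero_apply A l r)
    have hWψ' : W *ᵥ mpsOpenVar 0 A l' r' = fun _ => (1 : Matrix β β ℂ) b₀ c * (l' ⬝ᵥ r') := by
      funext σ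
      change ∑ τ, W σ τ * mpsOpenVar 0 A l' r' τ = _
      rw [Fintype.sum_unique, hK, mpsOpenVar_zero_apply]
    have hL : star (mpsOpenVar 0 A l r) ⬝ᵥ (W *ᵥ mpsOpenVar 0 A l' r') =
        (1 : Matrix β β ℂ) b₀ c * (star (l ⬝ᵥ r) * (l' ⬝ᵥ r')) := by
      rw [hWψ', hψ]
      change ∑ σ : TensorIndex (Fin 0) q, star (l ⬝ᵥ r) * ((1 : Matrix β β ℂ) b₀ c * (l' ⬝ᵥ r')) = _
      rw [Fintype.sum_unique]
      ring
    have hv : vecMulVec (star l) l' *ᵥ r' = (l' ⬝ᵥ r') • star l := by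
      ext i
      simp only [mulVec, dotProduct, vecMulVec_apply, Pi.smul_apply, Pi.star_apply, smul_eq_mul,
        Finset.sum_mul, mul_assoc, mul_comm (star (l i))]
    have hR : star r ⬝ᵥ ((Pi.single b₀ (vecMulVec (star l) l') : β → Matrix (Fin D) (Fin D) ℂ) c *ᵥ r') =
        (1 : Matrix β β ℂ) b₀ c * (star (l ⬝ᵥ r) * (l' ⬝ᵥ r')) := by
      by_cases hbc : b₀ = c
      · subst hbc
        rw [Pi.single_eq_same, Matrix.one_apply_eq, one_mul, hv, dotProduct_smul, star_dotProduct_star,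
          smul_eq_mul, mul_comm]
      · rw [Pi.single_eq_of_ne (Ne.symm hbc), Matrix.one_apply_ne hbc, zero_mulVec, dotProduct_zero,
          zero_mul]
    rw [automatonSweep_zero, hL, hR]
  | L + 1, A, O, b₀, c, W, hW, l, l', r, r' => by
    -- kernels of the `L`-site automaton on `O ∘ succ`, from state `b₁` to `c`
    have hW' : ∀ (b₁ : β) (σ τ : TensorIndex (Fin L) q),
        (Matrix.of fun σ τ : TensorIndex (Fin L) q => automatonKernel L (fun k => O k.succ) σ τ b₁ c) σ τ =
          automatonKernel L (fun k => O k.succ) σ τ b₁ c := fun b₁ σ τ => rfl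
    have ih := fun (b₁ : β) (s s' : Fin q) =>
      inner_mulVec_mpsOpenVar_eq_automatonSweep L (fun j => A j.succ) (fun k => O k.succ) b₁ c _ (hW' b₁)
        (l ᵥ* A 0 s) (l' ᵥ* A 0 s') r r'
    -- (1) the left-hand side, peeled; the `b₁`-sum stays inside the kernel of the `L`-site operator
    have hLHS : star (mpsOpenVar (L + 1) A l r) ⬝ᵥ (W *ᵥ mpsOpenVar (L + 1) A l' r') =
        ∑ s, ∑ s', (star (mpsOpenVar L (fun j => A j.succ) (l ᵥ* A 0 s) r) ⬝ᵥ
          ((Matrix.of fun σ τ : TensorIndex (Fin L) q =>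
              ∑ b₁, O 0 b₀ b₁ s s' * automatonKernel L (fun k => O k.succ) σ τ b₁ c) *ᵥ
            mpsOpenVar L (fun j => A j.succ) (l' ᵥ* A 0 s') r')) := by
      simp only [dotProduct, mulVec, Pi.star_apply, hW, Matrix.of_apply]
      rw [sum_config_succ]
      refine Finset.sum_congr rfl fun s _ => ?_
      simp only [sum_config_succ L (fun τ => automatonKernel (L + 1) O _ τ b₀ c *
          mpsOpenVar (L + 1) A l' r' τ),
        automatonKernel_succ_cons, mpsOpenVar_succ_cons, Matrix.mul_apply, Matrix.of_apply]
      -- `Σ_σ′ a σ′ · Σ_s′ Σ_τ′ k σ′ τ′ · b_{s′} τ′ = Σ_s′ Σ_σ′ a σ′ · Σ_τ′ k σ′ τ′ · b_{s′} τ′`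
      simp only [Finset.mul_sum]
      rw [Finset.sum_comm]
    -- (1′) linearity in the kernel: pull the `b₁`-sum out of the matrix element
    have hsplit : ∀ s s' : Fin q,
        star (mpsOpenVar L (fun j => A j.succ) (l ᵥ* A 0 s) r) ⬝ᵥ
          ((Matrix.of fun σ τ : TensorIndex (Fin L) q =>
              ∑ b₁, O 0 b₀ b₁ s s' * automatonKernel L (fun k => O k.succ) σ τ b₁ c) *ᵥ
            mpsOpenVar L (fun j => A j.succ) (l' ᵥ* A 0 s') r') =
        ∑ b₁, O 0 b₀ b₁ s s' *
          (star (mpsOpenVar L (fun j => A j.succ) (l ᵥ* A 0 s) r) ⬝ᵥ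
            ((Matrix.of fun σ τ : TensorIndex (Fin L) q =>
                automatonKernel L (fun k => O k.succ) σ τ b₁ c) *ᵥ
              mpsOpenVar L (fun j => A j.succ) (l' ᵥ* A 0 s') r')) := by
      intro s s'
      have hsum : (Matrix.of fun σ τ : TensorIndex (Fin L) q =>
            ∑ b₁, O 0 b₀ b₁ s s' * automatonKernel L (fun k => O k.succ) σ τ b₁ c) =
          ∑ b₁, O 0 b₀ b₁ s s' • (Matrix.of fun σ τ : TensorIndex (Fin L) q =>
            automatonKernel L (fun k => O k.succ) σ τ b₁ c) := by
        ext σ τ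
        simp only [Matrix.of_apply, Matrix.sum_apply, Matrix.smul_apply, smul_eq_mul]
      rw [hsum, Matrix.sum_mulVec, dotProduct_sum]
      simp only [Matrix.smul_mulVec, dotProduct_smul, smul_eq_mul]
    -- (2) the right-hand side, peeled: linearity of the sweep over the recombined boundary family
    have hRHS : star r ⬝ᵥ (automatonSweep (L + 1) A O (Pi.single b₀ (vecMulVec (star l) l')) c *ᵥ r') =
        ∑ s, ∑ s', ∑ b₁, O 0 b₀ b₁ s s' * (star r ⬝ᵥ
          (automatonSweep L (fun j => A j.succ) (fun k => O k.succ)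
            (Pi.single b₁ (vecMulVec (star (l ᵥ* A 0 s)) (l' ᵥ* A 0 s'))) c *ᵥ r')) := by
      rw [automatonSweep, LinearMap.comp_apply, automatonStep_single]
      simp only [map_sum, map_smul, Finset.sum_apply, Pi.smul_apply, Matrix.sum_mulVec, Matrix.smul_mulVec,
        dotProduct_sum, dotProduct_smul, smul_eq_mul]
    rw [hLHS, hRHS]
    refine Finset.sum_congr rfl fun s _ => Finset.sum_congr rfl fun s' _ => ?_
    rw [hsplit s s']
    refine Finset.sum_congr rfl fun b₁ _ => ?_
    rw [ih b₁ s s']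

end Summit.Ventures.CertifiedManyBodySolver.Upper.IntervalReader

end
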